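import Mathlib
import Summits.Ventures.PercRepro.PuncturedLYMUnif56Table
import Summits.Ventures.PercRepro.PuncturedLYMUnif56Rows1
import Summits.Ventures.PercRepro.PuncturedLYMUnif56Rows2
import Summits.Ventures.PercRepro.PuncturedLYMUnif56Rows3

/-!
# PercRepro — (SP) FOR ANY NUMBER OF PAIRWISE DISJOINT `5`-SETS AT LEVEL `6`: THE ROW IDENTITIES, ASSEMBLED
(p10, gen 40)

`row_check`: the row identity of every class with `Σ v c_v ≤ 6`, by `interval_cases` over the class counts.  Nothing here asserts (SP).
-/

namespace PercRepro.PuncturedLYM.Split.TypeLift.Unif56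

/-- The row identity of every class, in one statement. -/
theorem row_check (n k : ℚ) (hQ : Qp n k ≠ 0) (hP : Pp n k ≠ 0) (hPc : Pc n k ≠ 0) (c1 c2 c3 c4 : ℕ)
    (h : c1 + 2 * c2 + 3 * c3 + 4 * c4 ≤ 6) :
    5 * (k - ((c1 : ℚ) + c2 + c3 + c4)) * raw n k c1 c2 c3 c4 0 + 4 * (c1 : ℚ) * raw n k c1 c2 c3 c4 1 + 3 * (c2 : ℚ) * raw n k c1 c2 c3 c4 2 + 2 * (c3 : ℚ) * raw n k c1 c2 c3 c4 3 + (c4 : ℚ) / 5 +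
      (n - 5 * k - ((6 : ℚ) - c1 - 2 * c2 - 3 * c3 - 4 * c4)) * raw n k c1 c2 c3 c4 5 = Yc n / Pc n k := by
  have hb1 : c1 ≤ 6 := by omega
  have hb2 : c2 ≤ 3 := by omega
  have hb3 : c3 ≤ 2 := by omega
  have hb4 : c4 ≤ 1 := by omega
  interval_cases c1 <;> interval_cases c2 <;> interval_cases c3 <;> interval_cases c4 <;> push_cast
  · linear_combination row_0000 n k hQ hP hPc
  · linear_combination row_0001 n k hQ hP hPc
  · linear_combination row_0010 n k hQ hP hPc
  · omega
  · linear_combination row_0020 n k hQ hP hPc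
  · omega
  · linear_combination row_0100 n k hQ hP hPc
  · linear_combination row_0101 n k hQ hP hPc
  · linear_combination row_0110 n k hQ hP hPc
  · omega
  · omega
  · omega
  · linear_combination row_0200 n k hQ hP hPc
  · omega
  · omega
  · omega
  · omega
  · omega
  · linear_combination row_0300 n k hQ hP hPc
  · omega
  · omega
  · omega
  · omega
  · omega
  · linear_combination row_1000 n k hQ hP hPc
  · linear_combination row_1001 n k hQ hP hPc
  · linear_combination row_1010 n k hQ hP hPc
  · omega
  · omega
  · omega
  · linear_combination row_1100 n k hQ hP hPc
  · omega
  · linear_combination row_1110 n k hQ hP hPc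
  · omega
  · omega
  · omega
  · linear_combination row_1200 n k hQ hP hPc
  · omega
  · omega
  · omega
  · omega
  · omega
  · omega
  · omega
  · omega
  · omega
  · omega
  · omega
  · linear_combination row_2000 n k hQ hP hPc
  · linear_combination row_2001 n k hQ hP hPc
  · linear_combination row_2010 n k hQ hP hPc
  · omega
  · omega
  · omega
  · linear_combination row_2100 n k hQ hP hPc
  · omega
  · omega
  · omega
  · omega
  · omega
  · linear_combination row_2200 n k hQ hP hPc
  · omega
  · omega
  · omega
  · omega
  · omega
  · omega
  · omega
  · omega
  · omega
  · omega
  · omega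
  · linear_combination row_3000 n k hQ hP hPc
  · omega
  · linear_combination row_3010 n k hQ hP hPc
  · omega
  · omega
  · omega
  · linear_combination row_3100 n k hQ hP hPc
  · omega
  · omega
  · omega
  · omega
  · omega
  · omega
  · omega
  · omega
  · omega
  · omega
  · omega
  · omega
  · omega
  · omega
  · omega
  · omega
  · omega
  · linear_combination row_4000 n k hQ hP hPc
  · omega
  · omega
  · omega
  · omega
  · omega
  · linear_combination row_4100 n k hQ hP hPc
  · omega
  · omega
  · omega
  · omega
  · omega
  · omega
  · omega
  · omega
  · omega
  · omega
  · omega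
  · omega
  · omega
  · omega
  · omega
  · omega
  · omega
  · linear_combination row_5000 n k hQ hP hPc
  · omega
  · omega
  · omega
  · omega
  · omega
  · omega
  · omega
  · omega
  · omega
  · omega
  · omega
  · omega
  · omega
  · omega
  · omega
  · omega
  · omega
  · omega
  · omega
  · omega
  · omega
  · omega
  · omega
  · linear_combination row_6000 n k hQ hP hPc
  · omega
  · omega
  · omega
  · omega
  · omega
  · omega
  · omega
  · omega
  · omega
  · omega
  · omega
  · omega
  · omega
  · omega
  · omega
  · omega
  · omega
  · omega
  · omega
  · omega
  · omega
  · omega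
  · omega

end PercRepro.PuncturedLYM.Split.TypeLift.Unif56
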